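import Mathlib
import Summits.Ventures.PercRepro2.Defs
import Summits.Ventures.PercRepro2.Harris
import Summits.Ventures.PercRepro2.Graph
import Summits.Ventures.PercRepro2.Events
import Summits.Ventures.PercRepro2.CondAvoidPA
import Summits.Ventures.PercRepro2.MixedBoxDefs
import Summits.Ventures.PercRepro2.ReachClosure
import Summits.Ventures.PercRepro2.ReachBits

/-!
# Cell-conditional monotonicity of the three-status law is FALSE: a kernel-checked refutation
(blind cell PercRepro2, mine-1 g50; proofs/MINE1-UNIONROW-K3.md §17.7, MINE-1.md §67.8)

The status law of three observed vertices `u, v, w` given `s ↮ t` (`status`: `2` = in the cluster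
of `s`, `0` = in the cluster of `t`, `1` = in neither; `MixedBoxDefs`) suggests the family of
CELL-CONDITIONAL MONOTONICITY facts: for two cells `c₁ ≤ c₂` of the `(u, w)`-coordinates (the order
`T < N < S` on each), the conditional probability that `v` lies in the cluster of `s` should not
decrease when the other two statuses move up,

  `P(σ_v = S ∧ (σ_u, σ_w) = c₁ ∧ s ↮ t) · P((σ_u, σ_w) = c₂ ∧ s ↮ t)
     ≤ P(σ_v = S ∧ (σ_u, σ_w) = c₂ ∧ s ↮ t) · P((σ_u, σ_w) = c₁ ∧ s ↮ t)`   (`CellMono c₁ c₂`).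

These facts are outside the positive-association currency (cells are not up-sets); 49 of the 81
hold on 150 random laws with at most six vertices, and the ones that separate the lane's abstract
witnesses (`TS ≤ NS`, `ST ≤ SN`, `TT ≤ NT`) were refuted by adversarial weight climbs within
seconds.  THE WITNESS for `TS ≤ NS` (`c₁ = (T, S)`, `c₂ = (N, S)`): six vertices, the six edges
`0–2, 0–5, 4–5, 3–5, 1–5, 2–4`, every weight `1/2`, roots `s = 0`, `t = 1`, observed `u = 3`,
`v = 2`, `w = 4`.  Mechanism: `5` is a hub joined to `s`, `t`, `u`, `w`; `u ∈ C_t` forces the hub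
into the cluster of `t`, so `w ∈ C_s` can only happen through `v` (`w – v – s`) — and then `v ∈ C_s`
is FORCED (`h(TS) = 1`), while with `u` in neither cluster the hub may be cut off and `w` may reach
`s` through the hub with `v` cut off (`h(NS) = 8/9`).  Over the `2⁶` configurations (weight `1/64`
each): `m(TSS) = 1`, `m(T·S) = 1`, `m(NSS) = 8`, `m(N·S) = 9`, so `1 · 9 > 8 · 1`.  The masses are
decided by the kernel with the bitmask reachability of `ReachBits` (`statusF`), as in the lane's
`MixedBoxRefutationsC`.  Definitions: the predicate `CellMono`, the witness graph and weights, the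
cell sets; decidability instances for the bitmask decision only; no notation; one seat.
-/

namespace Summit.Ventures.PercRepro2

/-- The cell `c = (a, b)` of the `(u, w)`-coordinates with the `v`-coordinate free: the status
triples `(a, x, b)`, `x ∈ {T, N, S}`. -/
def cellCol (c : Fin 3 × Fin 3) : Finset (Fin 3 × Fin 3 × Fin 3) :=
  {(c.1, 0, c.2), (c.1, 1, c.2), (c.1, 2, c.2)}

/-- The cell `c = (a, b)` of the `(u, w)`-coordinates with `v` in the cluster of `s`: the single
status triple `(a, S, b)`. -/
def cellS (c : Fin 3 × Fin 3) : Finset (Fin 3 × Fin 3 × Fin 3) := {(c.1, 2, c.2)}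

/-- **Cell-conditional monotonicity** from the cell `c₁` to the cell `c₂` of the `(u, w)`-statuses:
on `{s ↮ t}`, `P(σ_v = S | (σ_u, σ_w) = c₁) ≤ P(σ_v = S | (σ_u, σ_w) = c₂)`, written without
divisions — for every admissible rational weight vector, every finite graph with roots `s, t` and
observed vertices `u, v, w`.  (The event `{s ↮ t}` is the empty box `boxEvent ∅ ∅`.) -/
def CellMono (c₁ c₂ : Fin 3 × Fin 3) : Prop :=
  ∀ (V E : Type) [Fintype V] [DecidableEq V] [Fintype E] [DecidableEq E] (p : E → ℚ),
    IsProbVec p → ∀ (ends : E → Sym2 V) (s t u v w : V),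
    (let Q := MixedBox.boxEvent ends s t u v w ∅ ∅
     prob p (MixedBox.gridEvent ends s t u v w (cellS c₁) ∩ Q) *
         prob p (MixedBox.gridEvent ends s t u v w (cellCol c₂) ∩ Q) ≤
       prob p (MixedBox.gridEvent ends s t u v w (cellS c₂) ∩ Q) *
         prob p (MixedBox.gridEvent ends s t u v w (cellCol c₁) ∩ Q))

namespace CellMonoRefutation

open MixedBox

section Fast

variable {n : ℕ} {E : Type*} [Fintype E] [DecidableEq E]

/-- `status` decided through the bitmask closure (`decConnB`) instead of the walk enumeration. -/
def statusF (ends : E → Sym2 (Fin n)) (s t x : Fin n) (ω : Config E) : Fin 3 :=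
  @ite _ (Conn ends ω s x) (decConnB ends ω s x) 2
    (@ite _ (Conn ends ω t x) (decConnB ends ω t x) 0 1)

omit [DecidableEq E] in
/-- The two decisions agree. -/
lemma status_eq_statusF (ends : E → Sym2 (Fin n)) (s t x : Fin n) (ω : Config E) :
    status ends s t x ω = statusF ends s t x ω := by
  unfold status statusF
  split_ifs <;> rfl

/-- Fast membership in `gridEvent`. -/
instance instDecGridEventF (ends : E → Sym2 (Fin n)) (s t u v w : Fin n)
    (S : Finset (Fin 3 × Fin 3 × Fin 3)) : DecidablePred (· ∈ gridEvent ends s t u v w S) :=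
  fun ω => decidable_of_iff
    ((statusF ends s t u ω, statusF ends s t v ω, statusF ends s t w ω) ∈ S)
    (by simp only [gridEvent, Set.mem_setOf_eq, status_eq_statusF])

/-- Fast membership in `boxEvent`. -/
instance instDecBoxEventF (ends : E → Sym2 (Fin n)) (s t u v w : Fin n) (X Y : Finset (Fin 3)) :
    DecidablePred (· ∈ boxEvent ends s t u v w X Y) :=
  fun ω => decidable_of_iff
    ((∀ x ∈ X.image ![u, v, w] ∪ {t},
        ¬ (ReachBits.closB (ReachBits.adjB (openGraph ends ω)) s n).testBit x = true) ∧
      (∀ x ∈ Y.image ![u, v, w] ∪ {s},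
        ¬ (ReachBits.closB (ReachBits.adjB (openGraph ends ω)) t n).testBit x = true))
    (by
      have hs : ∀ x : Fin n, (ReachBits.closB (ReachBits.adjB (openGraph ends ω)) s n).testBit x = true
          ↔ Conn ends ω s x := fun x => by
        rw [ReachBits.testBit_closB_iff]
        have h := Reach.reachable_iff_mem_reach (openGraph ends ω) s x
        rw [Fintype.card_fin] at h
        exact h.symm
      have ht : ∀ x : Fin n, (ReachBits.closB (ReachBits.adjB (openGraph ends ω)) t n).testBit x = true
          ↔ Conn ends ω t x := fun x => by
        rw [ReachBits.testBit_closB_iff]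
        have h := Reach.reachable_iff_mem_reach (openGraph ends ω) t x
        rw [Fintype.card_fin] at h
        exact h.symm
      simp only [boxEvent, CondAvoid.avoidEvent, Set.mem_inter_iff, Set.mem_setOf_eq, hs, ht])

end Fast

/-- The six edges of the witness graph on six vertices: `0–2, 0–5, 4–5, 3–5, 1–5, 2–4`. -/
def ends_w : Fin 6 → Sym2 (Fin 6) := ![s(0, 2), s(0, 5), s(4, 5), s(3, 5), s(1, 5), s(2, 4)]

/-- Every edge has weight `1/2`. -/
def p_w : Fin 6 → ℚ := fun _ => 1 / 2

/-- Integer weights: every configuration has weight `1` (in sixty-fourths). -/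
def wt_w : Config (Fin 6) → ℕ := fun _ => 1

/-- The weights are admissible. -/
lemma p_w_isProbVec : IsProbVec p_w := ⟨fun _ => by norm_num [p_w], fun _ => by norm_num [p_w]⟩

/-- `weight p_w ω = 1/64`. -/
lemma p_w_weight_eq (ω : Config (Fin 6)) : weight p_w ω = (wt_w ω : ℚ) / 64 := by
  unfold weight wt_w
  have h : ∀ e : Fin 6, edgeFactor (p_w e) (ω e) = 1 / 2 := fun e => by
    cases ω e <;> norm_num [p_w, edgeFactor]
  simp only [h, Finset.prod_const, Finset.card_univ, Fintype.card_fin]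
  norm_num

/-- Configurations on six edges as the numbers below `2⁶`: edge `e` is open iff bit `e` is set. -/
def e6 : Config (Fin 6) ≃ Fin (2 ^ 6) :=
  (Equiv.piCongrRight fun _ => finTwoEquiv.symm).trans finFunctionFinEquiv

/-- The configuration with bit pattern `k`. -/
def cfg6 (k : Fin (2 ^ 6)) : Config (Fin 6) := e6.symm k

/-- A mass on six edges as a sum over the `2⁶` bit patterns. -/
lemma mass_eq_sum6 (wt : Config (Fin 6) → ℕ) (A : Set (Config (Fin 6))) [DecidablePred (· ∈ A)] :
    mass wt A = ∑ k : Fin (2 ^ 6), if cfg6 k ∈ A then wt (cfg6 k) else 0 := by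
  rw [mass, Finset.sum_filter]
  exact Fintype.sum_equiv e6 _ _ (fun ω => by simp [cfg6])

/-- The cell `TS` of `(u, w)`. -/
def cTS : Fin 3 × Fin 3 := (0, 2)

/-- The cell `NS` of `(u, w)`. -/
def cNS : Fin 3 × Fin 3 := (1, 2)

set_option maxRecDepth 100000 in
set_option maxHeartbeats 4000000 in
/-- The integer masses of the witness (roots `0, 1`, observed `3, 2, 4`):
`m(TSS) · m(N·S) = 1 · 9 > 8 · 1 = m(NSS) · m(T·S)`. -/
theorem mass_w :
    mass wt_w (gridEvent ends_w 0 1 3 2 4 (cellS cNS) ∩ boxEvent ends_w 0 1 3 2 4 ∅ ∅) *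
        mass wt_w (gridEvent ends_w 0 1 3 2 4 (cellCol cTS) ∩ boxEvent ends_w 0 1 3 2 4 ∅ ∅) <
      mass wt_w (gridEvent ends_w 0 1 3 2 4 (cellS cTS) ∩ boxEvent ends_w 0 1 3 2 4 ∅ ∅) *
        mass wt_w (gridEvent ends_w 0 1 3 2 4 (cellCol cNS) ∩ boxEvent ends_w 0 1 3 2 4 ∅ ∅) := by
  rw [mass_eq_sum6, mass_eq_sum6, mass_eq_sum6, mass_eq_sum6]
  decide +kernel

/-- **Refutation glue**: integer masses with `m(c₂S∩Q)·m(c₁∩Q) < m(c₁S∩Q)·m(c₂∩Q)` refute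
`CellMono c₁ c₂`. -/
theorem not_cellMono_of_mass {n : ℕ} {E : Type} [Fintype E] [DecidableEq E]
    {p : E → ℚ} (hp : IsProbVec p) (ends : E → Sym2 (Fin n)) (s t u v w : Fin n)
    {wt : Config E → ℕ} {D : ℚ} (hD : 0 < D) (hw : ∀ ω, weight p ω = (wt ω : ℚ) / D)
    (c₁ c₂ : Fin 3 × Fin 3)
    (hm : mass wt (gridEvent ends s t u v w (cellS c₂) ∩ boxEvent ends s t u v w ∅ ∅) *
            mass wt (gridEvent ends s t u v w (cellCol c₁) ∩ boxEvent ends s t u v w ∅ ∅) <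
          mass wt (gridEvent ends s t u v w (cellS c₁) ∩ boxEvent ends s t u v w ∅ ∅) *
            mass wt (gridEvent ends s t u v w (cellCol c₂) ∩ boxEvent ends s t u v w ∅ ∅)) :
    ¬ CellMono c₁ c₂ := by
  intro h
  have key := h (Fin n) E p hp ends s t u v w
  simp only at key
  rw [prob_eq_mass_div hw, prob_eq_mass_div hw, prob_eq_mass_div hw, prob_eq_mass_div hw,
    div_mul_div_comm, div_mul_div_comm] at key
  have hDD : (0 : ℚ) < D * D := by positivity
  have key' := mul_le_mul_of_nonneg_right key hDD.le
  rw [div_mul_cancel₀ _ hDD.ne', div_mul_cancel₀ _ hDD.ne'] at key'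
  norm_cast at key'
  exact absurd key' (not_le.mpr hm)

set_option maxRecDepth 100000 in
set_option maxHeartbeats 1000000 in
/-- **Cell-conditional monotonicity `TS ≤ NS` is false**: on a finite graph with admissible
rational weights, `P(σ_v = S | σ_u = T, σ_w = S)` can exceed `P(σ_v = S | σ_u = N, σ_w = S)`
(here `1 > 8/9`). -/
theorem not_cellMono_TS_NS : ¬ CellMono cTS cNS :=
  not_cellMono_of_mass (wt := wt_w) (D := 64) p_w_isProbVec ends_w 0 1 3 2 4 (by norm_num)
    p_w_weight_eq cTS cNS mass_w

/-! ## Two more refuted comparisons: `TT ≤ NT` and `ST ≤ SN` (mine-1 g50, the same seat; paper §17.7)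
The other two cell comparisons that separated the lane's abstract witnesses fall on graphs of six
vertices at weight `1/2` as well.  `TT ≤ NT`: six edges `4–0, 1–0, 5–1, 2–4, 3–4, 5–3`, roots
`s = 2`, `t = 3`, cells of `(u, w) = (5, 0)`, conditioned vertex `v = 4`: `m(TSTᵥ) = 1`, `m(T·T) = 9`,
`m(NST) = 0`, `m(N·T) = 3` — so `h(TT) = 1/9 > 0 = h(NT)` and `1 · 3 > 0 · 9`.  `ST ≤ SN`: nine edges
`0–2, 4–0, 5–4, 3–0, 1–0, 2–4, 1–3, 5–2, 2–3`, roots `s = 4`, `t = 3`, cells of `(u, w) = (2, 1)`,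
conditioned vertex `v = 5`: `m(SST) = 34`, `m(S·T) = 43`, `m(SSN) = 26`, `m(S·N) = 33`, so
`34 · 33 = 1122 > 1118 = 26 · 43` (over the `2⁹` configurations). -/

/-- The six edges of the `TT ≤ NT` witness: `4–0, 1–0, 5–1, 2–4, 3–4, 5–3`. -/
def ends_x : Fin 6 → Sym2 (Fin 6) := ![s(4, 0), s(1, 0), s(5, 1), s(2, 4), s(3, 4), s(5, 3)]

/-- The cell `TT` of `(u, w)`. -/
def cTT : Fin 3 × Fin 3 := (0, 0)

/-- The cell `NT` of `(u, w)`. -/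
def cNT : Fin 3 × Fin 3 := (1, 0)

set_option maxRecDepth 100000 in
set_option maxHeartbeats 4000000 in
/-- The integer masses of the `TT ≤ NT` witness (roots `2, 3`, observed `5, 4, 0`):
`m(NST) · m(T·T) = 0 · 9 < 1 · 3 = m(TST) · m(N·T)`. -/
theorem mass_x :
    mass wt_w (gridEvent ends_x 2 3 5 4 0 (cellS cNT) ∩ boxEvent ends_x 2 3 5 4 0 ∅ ∅) *
        mass wt_w (gridEvent ends_x 2 3 5 4 0 (cellCol cTT) ∩ boxEvent ends_x 2 3 5 4 0 ∅ ∅) <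
      mass wt_w (gridEvent ends_x 2 3 5 4 0 (cellS cTT) ∩ boxEvent ends_x 2 3 5 4 0 ∅ ∅) *
        mass wt_w (gridEvent ends_x 2 3 5 4 0 (cellCol cNT) ∩ boxEvent ends_x 2 3 5 4 0 ∅ ∅) := by
  rw [mass_eq_sum6, mass_eq_sum6, mass_eq_sum6, mass_eq_sum6]
  decide +kernel

set_option maxRecDepth 100000 in
set_option maxHeartbeats 1000000 in
/-- **Cell-conditional monotonicity `TT ≤ NT` is false**: `P(σ_v = S | σ_u = T, σ_w = T)` can exceed
`P(σ_v = S | σ_u = N, σ_w = T)` (here `1/9 > 0`). -/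
theorem not_cellMono_TT_NT : ¬ CellMono cTT cNT :=
  not_cellMono_of_mass (wt := wt_w) (D := 64) p_w_isProbVec ends_x 2 3 5 4 0 (by norm_num)
    p_w_weight_eq cTT cNT mass_x

/-- The nine edges of the `ST ≤ SN` witness: `0–2, 4–0, 5–4, 3–0, 1–0, 2–4, 1–3, 5–2, 2–3`. -/
def ends_y : Fin 9 → Sym2 (Fin 6) :=
  ![s(0, 2), s(4, 0), s(5, 4), s(3, 0), s(1, 0), s(2, 4), s(1, 3), s(5, 2), s(2, 3)]

/-- Every edge has weight `1/2`. -/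
def p_y : Fin 9 → ℚ := fun _ => 1 / 2

/-- Integer weights: every configuration has weight `1` (in `512`-ths). -/
def wt_y : Config (Fin 9) → ℕ := fun _ => 1

/-- The weights are admissible. -/
lemma p_y_isProbVec : IsProbVec p_y := ⟨fun _ => by norm_num [p_y], fun _ => by norm_num [p_y]⟩

/-- `weight p_y ω = 1/512`. -/
lemma p_y_weight_eq (ω : Config (Fin 9)) : weight p_y ω = (wt_y ω : ℚ) / 512 := by
  unfold weight wt_y
  have h : ∀ e : Fin 9, edgeFactor (p_y e) (ω e) = 1 / 2 := fun e => by
    cases ω e <;> norm_num [p_y, edgeFactor]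
  simp only [h, Finset.prod_const, Finset.card_univ, Fintype.card_fin]
  norm_num

/-- Configurations on nine edges as the numbers below `2⁹`. -/
def e9 : Config (Fin 9) ≃ Fin (2 ^ 9) :=
  (Equiv.piCongrRight fun _ => finTwoEquiv.symm).trans finFunctionFinEquiv

/-- The configuration with bit pattern `k`. -/
def cfg9 (k : Fin (2 ^ 9)) : Config (Fin 9) := e9.symm k

/-- A mass on nine edges as a sum over the `2⁹` bit patterns. -/
lemma mass_eq_sum9 (wt : Config (Fin 9) → ℕ) (A : Set (Config (Fin 9))) [DecidablePred (· ∈ A)] :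
    mass wt A = ∑ k : Fin (2 ^ 9), if cfg9 k ∈ A then wt (cfg9 k) else 0 := by
  rw [mass, Finset.sum_filter]
  exact Fintype.sum_equiv e9 _ _ (fun ω => by simp [cfg9])

/-- The cell `ST` of `(u, w)`. -/
def cST : Fin 3 × Fin 3 := (2, 0)

/-- The cell `SN` of `(u, w)`. -/
def cSN : Fin 3 × Fin 3 := (2, 1)

set_option maxRecDepth 100000 in
set_option maxHeartbeats 8000000 in
/-- The integer masses of the `ST ≤ SN` witness (roots `4, 3`, observed `2, 5, 1`):
`m(SSN) · m(S·T) = 26 · 43 = 1118 < 1122 = 34 · 33 = m(SST) · m(S·N)`. -/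
theorem mass_y :
    mass wt_y (gridEvent ends_y 4 3 2 5 1 (cellS cSN) ∩ boxEvent ends_y 4 3 2 5 1 ∅ ∅) *
        mass wt_y (gridEvent ends_y 4 3 2 5 1 (cellCol cST) ∩ boxEvent ends_y 4 3 2 5 1 ∅ ∅) <
      mass wt_y (gridEvent ends_y 4 3 2 5 1 (cellS cST) ∩ boxEvent ends_y 4 3 2 5 1 ∅ ∅) *
        mass wt_y (gridEvent ends_y 4 3 2 5 1 (cellCol cSN) ∩ boxEvent ends_y 4 3 2 5 1 ∅ ∅) := by
  rw [mass_eq_sum9, mass_eq_sum9, mass_eq_sum9, mass_eq_sum9]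
  decide +kernel

set_option maxRecDepth 100000 in
set_option maxHeartbeats 1000000 in
/-- **Cell-conditional monotonicity `ST ≤ SN` is false**: `P(σ_v = S | σ_u = S, σ_w = T)` can exceed
`P(σ_v = S | σ_u = S, σ_w = N)` (here `34/43 > 26/33`). -/
theorem not_cellMono_ST_SN : ¬ CellMono cST cSN :=
  not_cellMono_of_mass (wt := wt_y) (D := 512) p_y_isProbVec ends_y 4 3 2 5 1 (by norm_num)
    p_y_weight_eq cST cSN mass_y

end CellMonoRefutation

end Summit.Ventures.PercRepro2
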